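import Mathlib
import Summits.ResolutionOfSingularities.ResolutionOfSingularities.Theorems.FrobeniusLadderFRationalResolutionCompletedBaseChangeFibreDescent
import Summits.ResolutionOfSingularities.ResolutionOfSingularities.Theorems.FrobeniusLadderFRationalResolutionCompletedBaseChangeFibreStalks
import Summits.ResolutionOfSingularities.ResolutionOfSingularities.Theorems.FrobeniusLadderFRationalResolutionCompletedBaseChangeFibreChart
import Summits.ResolutionOfSingularities.ResolutionOfSingularities.Theorems.FrobeniusLadderFRationalResolutionCompletedBaseChangeFibreDownFinite
import Literature.AlgebraicGeometry.Resolution.BlowupChartTransition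

/-!
# Crux `FrobeniusLadder.FRationalResolution` (stmt-ResolutionOfSingularities-15317), line `redirect`,
# stub `stub_diagonalizableQuotientResolution` — THE DOWN DIRECTION THROUGH THE COMPLETION for the two-step étale descent (ε):
# two-step data on `Bl_{I(C_𝔮)^}(Spec (C_𝔮)^)` give two-step data on `Bl_I(Spec C)` over `V(𝔮)`

`…CompletedBaseChangeFibreDown` / `…DownFinite` (p842590, p842601) come down from the LOCALIZATION `C_𝔮`; the two-step étale descent
`…EtaleChartTwoStep` (p842696) consumes data on `Bl` over `C_𝔔`; but the MODEL produces data on `Bl` over the COMPLETION `(C_𝔔)^`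
(`…CompletedBaseChangeFibreFinite/Points/Transport`, via `(T_𝔳)^ ≅ (C_𝔔)^`). This file comes down from the completion DIRECTLY to `C`
(model form of the fibre engine, `T := C`, `𝔳 := 𝔮`, `B := (C_𝔮)^`: flat, `B = C + 𝔮B`, `𝔮B ∩ C = 𝔮` — `…CompletedBaseChangeFibreFlat` §4),
replacing the G-ring transfer of `…Down` by the G-ring-free descent `…CompletedBaseChangeFibreDescent` (p842938):
* `isRegular_affineBlowup_maximalIdeal_descent_of_presentation` — descent of `Bl_𝔪`-regularity along a PRESENTED base change
  `Θ : C' ⊗_A B ≅ C''` (the chart rings `C[I/x_i] ⊗_C B ≅ B[IB/x_i]`);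
* ★★★ `hloc_stalk_down_completion` — point-blow-up regularity at the non-regular points of `Bl_{I(C_𝔮)^}(Spec (C_𝔮)^)` gives it at the
  non-regular points of `Bl_I(Spec C)` over `V(𝔮)` (`C` Noetherian, `𝔮` maximal, `I = (x₁, …, x_n)`);
* ★★★ `finite_singular_over_of_finite_completion` — finitely many singular points upstairs ⇒ finitely many singular points of
  `Bl_I(Spec C)` over `V(𝔮)`.

Honest label: plumbing toward ONE leaf stub (no stub, crux or summit closed). No definitions, no named facts, no sorry.
[cite: StacksProject, Tag 0804; Tag 0C4G] [cite: Matsumura1987, Thm. 8.8; Thm. 8.11; Thm. 8.14; Thm. 23.7] [cite: GortzWedhorn2020, (13.19) p. 415]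
-/

noncomputable section

-- single-problem summit: the doubled namespace component is forced
set_option linter.dupNamespace false

open IsLocalRing AlgebraicGeometry CategoryTheory
open scoped TensorProduct
open Literature.AlgebraicGeometry.Resolution

namespace Summit.ResolutionOfSingularities.ResolutionOfSingularities.Theorems.FRationalResolution.CompletedBaseChangeFibreDownCompletion

/-! ## §1 Descent of `Bl_𝔪`-regularity along a presented base change -/

/-- **Descent of `Bl_𝔪`-regularity along a PRESENTED base change** `Θ : C ⊗_A B ≅ C'` compatible with `ψ : C → C'` (`B` flat over
`A`, `B = A + 𝔪B`, `C` Noetherian): for a prime `𝔑'` of `C'` over `V(𝔪C)`, `Bl_𝔪(Spec C'_{𝔑'})` regular ⇒ `Bl_𝔪(Spec C_{ψ⁻¹𝔑'})` regular.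
[cite: Matsumura1987, Thm. 23.7 (i)] [cite: StacksProject, Tag 0C4G] -/
theorem isRegular_affineBlowup_maximalIdeal_descent_of_presentation {A B C C' : Type} [CommRing A] [CommRing B] [CommRing C]
    [CommRing C'] [Algebra A B] [Algebra A C] [Module.Flat A B] [IsNoetherianRing C] (𝔪 : Ideal A)
    (hres : ∀ b : B, ∃ x : A, b - algebraMap A B x ∈ 𝔪.map (algebraMap A B))
    (ψ : C →+* C') (Θ : C ⊗[A] B ≃+* C') (hΘ : ∀ c : C, Θ (algebraMap C (C ⊗[A] B) c) = ψ c)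
    (𝔑' : Ideal C') [𝔑'.IsPrime] (h𝔑' : 𝔪.map (algebraMap A C) ≤ 𝔑'.comap ψ)
    (h : Scheme.IsRegular (affineBlowup (R := Localization.AtPrime 𝔑') (maximalIdeal _))) :
    Scheme.IsRegular (affineBlowup (R := Localization.AtPrime (𝔑'.comap ψ)) (maximalIdeal _)) := by
  haveI h𝔑p : (𝔑'.comap Θ.toRingHom).IsPrime := Ideal.comap_isPrime _ _
  have hmem : ∀ s, s ∈ 𝔑'.comap Θ.toRingHom ↔ Θ s ∈ 𝔑' := fun s => Iff.rfl
  have h𝔑 : (𝔑'.comap Θ.toRingHom).comap (algebraMap C (C ⊗[A] B)) = 𝔑'.comap ψ := by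
    ext r
    rw [Ideal.mem_comap, hmem, hΘ, Ideal.mem_comap]
  obtain ⟨e⟩ := CompletedBaseChangeFibrePoints.nonempty_ringEquiv_localization_of_ringEquiv Θ (𝔑'.comap Θ.toRingHom) 𝔑' hmem
  have h1 := CompletedBaseChangeFibrePoints.isRegular_affineBlowup_maximalIdeal_of_ringEquiv
    (S := Localization.AtPrime (𝔑'.comap Θ.toRingHom)) e.symm h
  exact CompletedBaseChangeFibreDescent.isRegular_affineBlowup_maximalIdeal_descent 𝔪 hres (𝔑'.comap ψ) h𝔑'
    (𝔑'.comap Θ.toRingHom) h𝔑 h1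

/-! ## §2 `hloc` down from the completion -/

/-- ★★★ **`hloc` DOWN from the completion.** `C` Noetherian, `𝔮` maximal, `I = (x₁, …, x_n)`, `Ê = (C_𝔮)^`: if the point blow-up
`Bl_{𝔪_w}(Spec 𝒪_w)` is regular at every non-regular point `w` of `Bl_{IÊ}(Spec Ê)`, then `Bl_{𝔪_z}(Spec 𝒪_z)` is regular at every
non-regular point `z` of `Bl_I(Spec C)` over `V(𝔮)`. [cite: Matsumura1987, Thm. 8.8; Thm. 8.14; Thm. 23.7] [cite: StacksProject, Tag 0804] -/
theorem hloc_stalk_down_completion (C : Type) [CommRing C] [IsNoetherianRing C] (𝔮 : Ideal C) [𝔮.IsMaximal]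
    {n : ℕ} (x : Fin n → C) (I : Ideal C) (hI : I = Ideal.span (Set.range x))
    (hloc' : ∀ w : affineBlowup (I.map (algebraMap C (AdicCompletion (maximalIdeal (Localization.AtPrime 𝔮)) (Localization.AtPrime 𝔮)))),
      ¬ IsRegularLocalRing ((affineBlowup (I.map (algebraMap C (AdicCompletion (maximalIdeal (Localization.AtPrime 𝔮)) (Localization.AtPrime 𝔮))))).presheaf.stalk w) →
      Scheme.IsRegular (affineBlowup (R := (affineBlowup (I.map (algebraMap C (AdicCompletion (maximalIdeal (Localization.AtPrime 𝔮)) (Localization.AtPrime 𝔮))))).presheaf.stalk w) (maximalIdeal _)))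
    (z : affineBlowup I) (hz𝔮 : 𝔮 ≤ (affineBlowup.π I z).asIdeal)
    (hz : ¬ IsRegularLocalRing ((affineBlowup I).presheaf.stalk z)) :
    Scheme.IsRegular (affineBlowup (R := (affineBlowup I).presheaf.stalk z) (maximalIdeal _)) := by
  haveI : IsNoetherianRing (Localization.AtPrime 𝔮) :=
    IsLocalization.isNoetherianRing 𝔮.primeCompl (Localization.AtPrime 𝔮) inferInstance
  haveI : IsNoetherianRing (AdicCompletion (maximalIdeal (Localization.AtPrime 𝔮)) (Localization.AtPrime 𝔮)) := isNoetherianRing_adicCompletion_maximalIdeal _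
  haveI := CompletedBaseChangeFibreFlat.flat_adicCompletion_atPrime C 𝔮
  have hres := CompletedBaseChangeFibreFlat.forall_exists_sub_mem_adicCompletion_atPrime C 𝔮
  have hinj := CompletedBaseChangeFibreFlat.comap_map_le_adicCompletion_atPrime C 𝔮
  -- the chart of `z`
  have hxI : ∀ i, x i ∈ I := fun i => hI ▸ Ideal.subset_span ⟨i, rfl⟩
  have hIle : I ≤ Ideal.span (Set.range x) := hI.le
  obtain ⟨i, 𝔫', h𝔫'p, hcomap, hiff, ⟨e_z⟩⟩ :=
    CompletedBaseChangeFibrePoints.exists_chart_prime_ringEquiv_stalk I x hxI hIle z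
  haveI := h𝔫'p
  have hxI' : algebraMap C (AdicCompletion (maximalIdeal (Localization.AtPrime 𝔮)) (Localization.AtPrime 𝔮)) (x i) ∈ I.map (algebraMap C (AdicCompletion (maximalIdeal (Localization.AtPrime 𝔮)) (Localization.AtPrime 𝔮))) := Ideal.mem_map_of_mem _ (hxI i)
  haveI : IsNoetherianRing (blowupAlgebra I (x i)) := isNoetherianRing_blowupAlgebra_of_isNoetherianRing I (x i)
  haveI : IsNoetherianRing (blowupAlgebra (I.map (algebraMap C (AdicCompletion (maximalIdeal (Localization.AtPrime 𝔮)) (Localization.AtPrime 𝔮)))) (algebraMap C (AdicCompletion (maximalIdeal (Localization.AtPrime 𝔮)) (Localization.AtPrime 𝔮)) (x i))) :=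
    isNoetherianRing_blowupAlgebra_of_isNoetherianRing _ _
  have h𝔫 : 𝔮.map (algebraMap C (blowupAlgebra I (x i))) ≤ 𝔫' := by
    rw [Ideal.map_le_iff_le_comap, hcomap]
    exact hz𝔮
  -- the chart rings: `Θ : C[I/x_i] ⊗ Ê ≅ Ê[IÊ/x_i]`, and the prime `𝔑'` upstairs over `𝔫'`
  obtain ⟨Θ, hΘ, -⟩ := CompletedBaseChangeFibreChart.exists_ringEquiv_tensor_blowupAlgebra I
    (I.map (algebraMap C (AdicCompletion (maximalIdeal (Localization.AtPrime 𝔮)) (Localization.AtPrime 𝔮)))) (x i) le_rfl le_rfl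
  obtain ⟨𝔑', ⟨h𝔑'p, h𝔑'c⟩, -⟩ := CompletedBaseChangeFibreChart.existsUnique_isPrime_comap_eq_blowupAlgebra I
    (I.map (algebraMap C (AdicCompletion (maximalIdeal (Localization.AtPrime 𝔮)) (Localization.AtPrime 𝔮)))) (x i) le_rfl le_rfl 𝔮 hres hinj 𝔫' h𝔫
  haveI := h𝔑'p
  subst h𝔑'c
  -- the point `w` of `Bl_{IÊ}(Spec Ê)` on the chart, with its stalk
  obtain ⟨e_w⟩ := CompletedBaseChangeFibreStalks.nonempty_ringEquiv_stalk_awayι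
    (I.map (algebraMap C (AdicCompletion (maximalIdeal (Localization.AtPrime 𝔮)) (Localization.AtPrime 𝔮)))) (algebraMap C (AdicCompletion (maximalIdeal (Localization.AtPrime 𝔮)) (Localization.AtPrime 𝔮)) (x i)) hxI'
    (PrimeSpectrum.comap (reesChartEquiv (I := I.map (algebraMap C (AdicCompletion (maximalIdeal (Localization.AtPrime 𝔮)) (Localization.AtPrime 𝔮)))) (algebraMap C (AdicCompletion (maximalIdeal (Localization.AtPrime 𝔮)) (Localization.AtPrime 𝔮)) (x i)) hxI').toRingHom ⟨𝔑', h𝔑'p⟩)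
    𝔑' (fun _ => Iff.rfl)
  -- `w` is singular
  have hregiff := CompletedBaseChangeFibreChart.isRegularLocalRing_iff_blowupAlgebra I
    (I.map (algebraMap C (AdicCompletion (maximalIdeal (Localization.AtPrime 𝔮)) (Localization.AtPrime 𝔮)))) (x i) le_rfl le_rfl 𝔮 hres 𝔑' h𝔫
  have hw : ¬ IsRegularLocalRing ((affineBlowup (I.map (algebraMap C (AdicCompletion (maximalIdeal (Localization.AtPrime 𝔮)) (Localization.AtPrime 𝔮))))).presheaf.stalk
      (Proj.awayι (reesGrading (I.map (algebraMap C (AdicCompletion (maximalIdeal (Localization.AtPrime 𝔮)) (Localization.AtPrime 𝔮))))) (reesT (algebraMap C (AdicCompletion (maximalIdeal (Localization.AtPrime 𝔮)) (Localization.AtPrime 𝔮)) (x i)) hxI')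
        (reesT_mem (algebraMap C (AdicCompletion (maximalIdeal (Localization.AtPrime 𝔮)) (Localization.AtPrime 𝔮)) (x i)) hxI') one_pos
        (PrimeSpectrum.comap (reesChartEquiv (I := I.map (algebraMap C (AdicCompletion (maximalIdeal (Localization.AtPrime 𝔮)) (Localization.AtPrime 𝔮)))) (algebraMap C (AdicCompletion (maximalIdeal (Localization.AtPrime 𝔮)) (Localization.AtPrime 𝔮)) (x i)) hxI').toRingHom
          ⟨𝔑', h𝔑'p⟩))) := by
    intro h
    apply hz
    haveI : IsRegularLocalRing (Localization.AtPrime 𝔑') := IsRegularLocalRing.of_ringEquiv (R' := Localization.AtPrime 𝔑') e_w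
    exact hiff.mpr (hregiff.mpr inferInstance)
  have h1 := CompletedBaseChangeFibrePoints.isRegular_affineBlowup_maximalIdeal_of_ringEquiv (S := Localization.AtPrime 𝔑') e_w
    (hloc' _ hw)
  -- descent along the presented base change `Θ` (no G-rings)
  have h2 := isRegular_affineBlowup_maximalIdeal_descent_of_presentation 𝔮 hres
    (blowupAlgebraMap (algebraMap C (AdicCompletion (maximalIdeal (Localization.AtPrime 𝔮)) (Localization.AtPrime 𝔮))) I (I.map (algebraMap C (AdicCompletion (maximalIdeal (Localization.AtPrime 𝔮)) (Localization.AtPrime 𝔮)))) (x i) le_rfl) Θ hΘ 𝔑' h𝔫 h1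
  exact CompletedBaseChangeFibrePoints.isRegular_affineBlowup_maximalIdeal_of_ringEquiv
    (R := Localization.AtPrime (𝔑'.comap (blowupAlgebraMap (algebraMap C (AdicCompletion (maximalIdeal (Localization.AtPrime 𝔮)) (Localization.AtPrime 𝔮))) I (I.map (algebraMap C (AdicCompletion (maximalIdeal (Localization.AtPrime 𝔮)) (Localization.AtPrime 𝔮)))) (x i) le_rfl)))
    (S := (affineBlowup I).presheaf.stalk z) e_z.symm h2

/-! ## §3 Finiteness down from the completion -/

/-- ★★★ **Finiteness DOWN from the completion.** `C` Noetherian, `𝔮` maximal, `I = (x₁, …, x_n)`, `Ê = (C_𝔮)^`: if `Bl_{IÊ}(Spec Ê)` has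
finitely many singular points, then `Bl_I(Spec C)` has finitely many singular points over `V(𝔮)`.
[cite: StacksProject, Tag 0804; Tag 0C4G] [cite: Matsumura1987, Thm. 8.14] [cite: GortzWedhorn2020, (13.19) p. 415] -/
theorem finite_singular_over_of_finite_completion (C : Type) [CommRing C] [IsNoetherianRing C] (𝔮 : Ideal C) [𝔮.IsMaximal]
    {n : ℕ} (x : Fin n → C) (I : Ideal C) (hI : I = Ideal.span (Set.range x))
    (hfin' : (Scheme.regularLocus (affineBlowup (I.map (algebraMap C (AdicCompletion (maximalIdeal (Localization.AtPrime 𝔮)) (Localization.AtPrime 𝔮))))))ᶜ.Finite) :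
    {z : affineBlowup I | 𝔮 ≤ (affineBlowup.π I z).asIdeal ∧
      ¬ IsRegularLocalRing ((affineBlowup I).presheaf.stalk z)}.Finite := by
  classical
  haveI : IsNoetherianRing (Localization.AtPrime 𝔮) :=
    IsLocalization.isNoetherianRing 𝔮.primeCompl (Localization.AtPrime 𝔮) inferInstance
  haveI : IsNoetherianRing (AdicCompletion (maximalIdeal (Localization.AtPrime 𝔮)) (Localization.AtPrime 𝔮)) := isNoetherianRing_adicCompletion_maximalIdeal _
  haveI := CompletedBaseChangeFibreFlat.flat_adicCompletion_atPrime C 𝔮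
  have hxI : ∀ i, x i ∈ I := fun i => hI ▸ Ideal.subset_span ⟨i, rfl⟩
  have hIle : I ≤ Ideal.span (Set.range x) := hI.le
  haveI : ∀ i, IsNoetherianRing (blowupAlgebra I (x i)) := fun i =>
    isNoetherianRing_blowupAlgebra_of_isNoetherianRing I (x i)
  haveI : ∀ i, IsNoetherianRing (blowupAlgebra (I.map (algebraMap C (AdicCompletion (maximalIdeal (Localization.AtPrime 𝔮)) (Localization.AtPrime 𝔮)))) (algebraMap C (AdicCompletion (maximalIdeal (Localization.AtPrime 𝔮)) (Localization.AtPrime 𝔮)) (x i))) := fun i =>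
    isNoetherianRing_blowupAlgebra_of_isNoetherianRing _ _
  have hres := CompletedBaseChangeFibreFlat.forall_exists_sub_mem_adicCompletion_atPrime C 𝔮
  have hinj := CompletedBaseChangeFibreFlat.comap_map_le_adicCompletion_atPrime C 𝔮
  have hxI' : ∀ i, algebraMap C (AdicCompletion (maximalIdeal (Localization.AtPrime 𝔮)) (Localization.AtPrime 𝔮)) (x i) ∈ I.map (algebraMap C (AdicCompletion (maximalIdeal (Localization.AtPrime 𝔮)) (Localization.AtPrime 𝔮))) := fun i => Ideal.mem_map_of_mem _ (hxI i)
  -- the finite sets of singular chart primes upstairs, then downstairs over `𝔮`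
  have hS' : ∀ i : Fin n, {𝔑' : PrimeSpectrum (blowupAlgebra (I.map (algebraMap C (AdicCompletion (maximalIdeal (Localization.AtPrime 𝔮)) (Localization.AtPrime 𝔮)))) (algebraMap C (AdicCompletion (maximalIdeal (Localization.AtPrime 𝔮)) (Localization.AtPrime 𝔮)) (x i))) |
      ¬ IsRegularLocalRing (Localization.AtPrime 𝔑'.asIdeal)}.Finite :=
    fun i => CompletedBaseChangeFibreDownFinite.finite_not_isRegularLocalRing_blowupAlgebra_of_finite _ _ (hxI' i) hfin'
  have hS : ∀ i : Fin n, {𝔫 : PrimeSpectrum (blowupAlgebra I (x i)) |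
      𝔮.map (algebraMap C (blowupAlgebra I (x i))) ≤ 𝔫.asIdeal ∧
        ¬ IsRegularLocalRing (Localization.AtPrime 𝔫.asIdeal)}.Finite := by
    intro i
    refine Set.Finite.subset ((hS' i).image (PrimeSpectrum.comap
      (blowupAlgebraMap (algebraMap C (AdicCompletion (maximalIdeal (Localization.AtPrime 𝔮)) (Localization.AtPrime 𝔮))) I (I.map (algebraMap C (AdicCompletion (maximalIdeal (Localization.AtPrime 𝔮)) (Localization.AtPrime 𝔮)))) (x i) le_rfl))) ?_
    rintro 𝔫 ⟨h𝔫, hreg⟩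
    haveI := 𝔫.isPrime
    obtain ⟨𝔑', ⟨h𝔑'p, h𝔑'c⟩, -⟩ := CompletedBaseChangeFibreChart.existsUnique_isPrime_comap_eq_blowupAlgebra I
      (I.map (algebraMap C (AdicCompletion (maximalIdeal (Localization.AtPrime 𝔮)) (Localization.AtPrime 𝔮)))) (x i) le_rfl le_rfl 𝔮 hres hinj 𝔫.asIdeal h𝔫
    haveI := h𝔑'p
    have h𝔫' : 𝔮.map (algebraMap C (blowupAlgebra I (x i))) ≤ 𝔑'.comap (blowupAlgebraMap (algebraMap C (AdicCompletion (maximalIdeal (Localization.AtPrime 𝔮)) (Localization.AtPrime 𝔮))) I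
        (I.map (algebraMap C (AdicCompletion (maximalIdeal (Localization.AtPrime 𝔮)) (Localization.AtPrime 𝔮)))) (x i) le_rfl) := by
      rw [h𝔑'c]; exact h𝔫
    have hiff := CompletedBaseChangeFibreChart.isRegularLocalRing_iff_blowupAlgebra I
      (I.map (algebraMap C (AdicCompletion (maximalIdeal (Localization.AtPrime 𝔮)) (Localization.AtPrime 𝔮)))) (x i) le_rfl le_rfl 𝔮 hres 𝔑' h𝔫'
    refine ⟨⟨𝔑', h𝔑'p⟩, ?_, ?_⟩
    · intro hreg'
      apply hreg
      have h1 := hiff.mpr hreg'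
      have htr := BlowupChartPoints.isRegularLocalRing_localization_iff_of_ringEquiv (RingEquiv.refl (blowupAlgebra I (x i)))
        (𝔑'.comap (blowupAlgebraMap (algebraMap C (AdicCompletion (maximalIdeal (Localization.AtPrime 𝔮)) (Localization.AtPrime 𝔮))) I (I.map (algebraMap C (AdicCompletion (maximalIdeal (Localization.AtPrime 𝔮)) (Localization.AtPrime 𝔮)))) (x i) le_rfl)) 𝔫.asIdeal
        (fun s => by rw [h𝔑'c]; exact Iff.rfl)
      exact htr.mp h1
    · exact PrimeSpectrum.ext h𝔑'c
  -- the chart maps on points, downstairs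
  let G : ∀ i : Fin n, PrimeSpectrum (blowupAlgebra I (x i)) → affineBlowup I := fun i 𝔫 =>
    Proj.awayι (reesGrading I) (reesT (x i) (hxI i)) (reesT_mem (x i) (hxI i)) one_pos
      (PrimeSpectrum.comap (reesChartEquiv (I := I) (x i) (hxI i)).toRingHom 𝔫)
  refine Set.Finite.subset (Set.finite_iUnion fun i => (hS i).image (G i)) ?_
  rintro z ⟨hz𝔮, hz⟩
  obtain ⟨i, q, 𝔫', h𝔫'p, hq, hmemq, hcomap, hiff⟩ := BlowupChartPoints.exists_chart_point_prime I x hxI hIle z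
  haveI := h𝔫'p
  refine Set.mem_iUnion.mpr ⟨i, ⟨𝔫', h𝔫'p⟩, ⟨?_, fun hreg => hz (hiff.mpr hreg)⟩, ?_⟩
  · change 𝔮.map (algebraMap C (blowupAlgebra I (x i))) ≤ 𝔫'
    rw [Ideal.map_le_iff_le_comap, hcomap]
    exact hz𝔮
  · have hpt : PrimeSpectrum.comap (reesChartEquiv (I := I) (x i) (hxI i)).toRingHom ⟨𝔫', h𝔫'p⟩ = q := by
      refine PrimeSpectrum.ext ?_
      ext s
      rw [PrimeSpectrum.comap_asIdeal, Ideal.mem_comap, hmemq]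
      exact Iff.rfl
    rw [← hq, ← hpt]

end Summit.ResolutionOfSingularities.ResolutionOfSingularities.Theorems.FRationalResolution.CompletedBaseChangeFibreDownCompletion

end
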